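import Literature.Algebra.Lie.SemisimpleDimensionThreeSimple
import HarnessLib

/-!
# A semisimple Lie algebra of dimension `6` is simple or the direct sum of two three-dimensional simple ideals

Topic `Literature/Algebra/Lie`. Theorems only (no definition, no named fact, D-0026), Mathlib vocabulary
(`LieAlgebra.IsSemisimple`, `LieAlgebra.IsSimple`, the Boolean algebra `LieIdeal K L` of a semisimple Lie algebra). Written for
the cell `pub-hodgecm2` (COR-CM), seat `b27` (count-neutral own lane MT-RANK-SEVEN-SPLIT): the Hodge Lie algebra of a complex
abelian variety with no factor of type IV and `dim MT(H¹X) = 7` is semisimple of dimension `6` (`CorCM/MumfordTateRankSix`), and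
this file is the `ℚ`-structure dichotomy `𝔰𝔩₂`-form `⊕` `𝔰𝔩₂`-form versus `ℚ`-simple (a form of `Res_{K/ℚ} 𝔰𝔩₂`).

PRINTED RESULT. J. E. Humphreys, GTM 9, §5.2 Thm. («`L` semisimple ⟹ `L = L₁ ⊕ … ⊕ L_t`, simple ideals, `[Lᵢ, Lⱼ] = 0`»)
with §8.4 (each simple `Lᵢ` has dimension `rankᵢ + #rootsᵢ ∉ {1, 2, 4, 5}`): for `dim L = 6` either `t = 1` or `t = 2` with
`dim L₁ = dim L₂ = 3`.  Folklore consequence; the dimension bounds are the tree's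
`SemisimpleSmallDimension.finrank_ne_of_hasTrivialRadical` / `three_le_finrank_of_isAtom`.

RESULTS (namespace `Literature.Algebra.Lie.SemisimpleSmallDimension`, field `K` of characteristic `0`, `L` finite-dimensional):
* `finrank_atom_ne_four_five` — an atom of a semisimple `L` has dimension `∉ {1, 2, 4, 5}` (it is simple, hence Killing by
  Mathlib's Cartan criterion);
* `isSimple_of_forall_isAtom_eq_top` — a non-zero semisimple `L` all of whose atoms are `⊤` is simple;
* **`isSimple_or_exists_isCompl_of_finrank_eq_six`** — `L` semisimple of dimension `6` ⟹ `L` is simple, or there are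
  complementary ideals `A ⊓ B = ⊥`, `A ⊔ B = ⊤` of dimension `3` each, both simple Lie algebras, with `⁅A, B⁆ = 0`.

## References
* [Humphreys1972] J. E. Humphreys, *Introduction to Lie Algebras and Representation Theory*, GTM 9 (1972), §5.2, §8.4.
-/

namespace Literature.Algebra.Lie

namespace SemisimpleSmallDimension

open LieAlgebra Module

variable {K L : Type*} [Field K] [CharZero K] [LieRing L] [LieAlgebra K L] [FiniteDimensional K L]

/-- **An atom of a semisimple Lie algebra has dimension `≠ 1, 2, 4, 5`**: it is a simple Lie algebra
(`LieAlgebra.IsSemisimple.isSimple_of_isAtom`), hence has trivial radical, and `finrank_ne_of_hasTrivialRadical` applies.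
[cite: Humphreys1972, §8.4] [cite: Humphreys1972, §5.2] -/
theorem finrank_atom_ne_four_five [LieAlgebra.IsSemisimple K L] {A : LieIdeal K L} (hA : IsAtom A) :
    finrank K A ≠ 1 ∧ finrank K A ≠ 2 ∧ finrank K A ≠ 4 ∧ finrank K A ≠ 5 := by
  haveI : LieAlgebra.IsSimple K A := LieAlgebra.IsSemisimple.isSimple_of_isAtom A hA
  haveI : Module.Finite K A := Module.Finite.of_injective A.toSubmodule.subtype Subtype.val_injective
  have h := finrank_ne_of_hasTrivialRadical (K := K) (L := A)
  exact ⟨h.1, h.2.1, h.2.2.1, h.2.2.2.1⟩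

omit [CharZero K] in
/-- **A non-zero semisimple Lie algebra all of whose atoms equal `⊤` is simple**: every non-zero ideal contains an atom
(the lattice of ideals is atomistic), hence is `⊤`. [cite: Humphreys1972, §5.2] -/
theorem isSimple_of_forall_isAtom_eq_top [LieAlgebra.IsSemisimple K L] (h0 : 0 < finrank K L)
    (hall : ∀ A : LieIdeal K L, IsAtom A → A = ⊤) : LieAlgebra.IsSimple K L := by
  haveI : Nontrivial L := Module.finrank_pos_iff.1 h0
  have hL : ¬ IsLieAbelian L := by
    intro hab
    haveI := hab
    have : Subsingleton L := LieAlgebra.subsingleton_of_hasTrivialRadical_lie_abelian K L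
    exact not_subsingleton L this
  rw [← LieAlgebra.isSimple_iff_of_not_isLieAbelian K L hL]
  refine ⟨fun I => ?_⟩
  rcases eq_bot_or_exists_atom_le I with hI | ⟨A, hA, hAI⟩
  · exact Or.inl hI
  · right
    rw [hall A hA] at hAI
    exact top_le_iff.1 hAI

omit [CharZero K] in
/-- Dimensions add up along a complementary pair of ideals. [folklore] -/
private theorem finrank_add_finrank_of_isCompl {A B : LieIdeal K L} (hc : IsCompl A B) :
    finrank K A + finrank K B = finrank K L := by
  have hc' : IsCompl (A : Submodule K L) (B : Submodule K L) := LieSubmodule.isCompl_toSubmodule.2 hc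
  have h1 := Submodule.finrank_sup_add_finrank_inf_eq (A : Submodule K L) (B : Submodule K L)
  rw [hc'.sup_eq_top, hc'.inf_eq_bot, finrank_top, finrank_bot, add_zero] at h1
  exact h1.symm

omit [CharZero K] [FiniteDimensional K L] in
/-- Elements of two ideals with trivial intersection commute: `⁅x, y⁆ ∈ A ⊓ B = ⊥`. [folklore] -/
private theorem lie_eq_zero_of_inf_eq_bot {A B : LieIdeal K L} (hAB : A ⊓ B = ⊥) {x y : L} (hx : x ∈ A) (hy : y ∈ B) :
    ⁅x, y⁆ = 0 := by
  have h1 : ⁅x, y⁆ ∈ B := B.lie_mem hy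
  have h2 : ⁅x, y⁆ ∈ A := by
    rw [← lie_skew, neg_mem_iff]
    exact A.lie_mem hx
  have h : ⁅x, y⁆ ∈ A ⊓ B := (LieSubmodule.mem_inf _ _ _).2 ⟨h2, h1⟩
  rw [hAB] at h
  exact (LieSubmodule.mem_bot _).1 h

/-- **A semisimple Lie algebra of dimension `6` over a field of characteristic `0` is simple, or the direct sum of two
commuting three-dimensional simple ideals.**  If some atom `A` is proper, then `dim A ≥ 3`, `dim A ∉ {4, 5}` and the
complementary ideal `Aᶜ ≠ ⊥` (Boolean algebra of ideals) contains an atom of dimension `≥ 3`; as `dim A + dim Aᶜ = 6`, both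
have dimension `3`, `Aᶜ` is that atom, and `⁅A, Aᶜ⁆ ⊆ A ⊓ Aᶜ = 0`.  Otherwise every atom is `⊤` and `L` is simple.
[cite: Humphreys1972, §5.2] [cite: Humphreys1972, §8.4] -/
theorem isSimple_or_exists_isCompl_of_finrank_eq_six [LieAlgebra.IsSemisimple K L] (h6 : finrank K L = 6) :
    LieAlgebra.IsSimple K L ∨
      ∃ A B : LieIdeal K L, IsCompl A B ∧ finrank K A = 3 ∧ finrank K B = 3 ∧
        LieAlgebra.IsSimple K A ∧ LieAlgebra.IsSimple K B ∧ (∀ x ∈ A, ∀ y ∈ B, ⁅x, y⁆ = 0) := by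
  by_cases hex : ∃ A : LieIdeal K L, IsAtom A ∧ A ≠ ⊤
  · right
    obtain ⟨A, hA, hne⟩ := hex
    have h3A := three_le_finrank_of_isAtom (K := K) hA
    have h45A := finrank_atom_ne_four_five (K := K) hA
    have hc : IsCompl A Aᶜ := isCompl_compl
    have hAc : Aᶜ ≠ ⊥ := by
      intro hbot
      apply hne
      have := hc.sup_eq_top
      rwa [hbot, sup_bot_eq] at this
    obtain ⟨B, hB, hBA⟩ := (eq_bot_or_exists_atom_le Aᶜ).resolve_left hAc
    have h3B := three_le_finrank_of_isAtom (K := K) hB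
    have hBle : finrank K B ≤ finrank K (Aᶜ : LieIdeal K L) :=
      Submodule.finrank_mono (show (B : Submodule K L) ≤ (Aᶜ : LieIdeal K L) from hBA)
    have hsum := finrank_add_finrank_of_isCompl (K := K) hc
    have e1 : finrank K (A : Submodule K L) = finrank K A := rfl
    have e2 : finrank K ((Aᶜ : LieIdeal K L) : Submodule K L) = finrank K (Aᶜ : LieIdeal K L) := rfl
    have e3 : finrank K (B : Submodule K L) = finrank K B := rfl
    have hA3 : finrank K A = 3 := by omega
    have hAc3 : finrank K (Aᶜ : LieIdeal K L) = 3 := by omega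
    -- `B = Aᶜ`, so `Aᶜ` is an atom
    have hBeq : B = Aᶜ := by
      apply le_antisymm hBA
      have hsub : (B : Submodule K L) = ((Aᶜ : LieIdeal K L) : Submodule K L) :=
        Submodule.eq_of_le_of_finrank_le hBA (by rw [e2, e3]; omega)
      exact le_of_eq ((LieSubmodule.toSubmodule_inj B (Aᶜ : LieIdeal K L)).1 hsub).symm
    have hAcatom : IsAtom (Aᶜ : LieIdeal K L) := hBeq ▸ hB
    haveI hAs : LieAlgebra.IsSimple K A := LieAlgebra.IsSemisimple.isSimple_of_isAtom A hA
    haveI hAcs : LieAlgebra.IsSimple K (Aᶜ : LieIdeal K L) := LieAlgebra.IsSemisimple.isSimple_of_isAtom _ hAcatom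
    exact ⟨A, Aᶜ, hc, hA3, hAc3, hAs, hAcs, fun x hx y hy => lie_eq_zero_of_inf_eq_bot hc.inf_eq_bot hx hy⟩
  · left
    push Not at hex
    exact isSimple_of_forall_isAtom_eq_top (by omega) hex

end SemisimpleSmallDimension

end Literature.Algebra.Lie
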